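import Mathlib.LinearAlgebra.Dual.Defs
import Mathlib.LinearAlgebra.BilinearMap
import Mathlib.LinearAlgebra.Prod
import Mathlib.Data.Complex.Basic
import Mathlib.Tactic.LinearCombination
import Mathlib.Tactic.Ring
import HarnessLib

/-!
# Venture HSemireg — WHICH `K`-secant planes satisfy (H1): Markman's `g_P` in the coordinates of the null space `W₁`
# (TRACK S4-PUSH (ii), seat `s4-prove-1`, ATTEMPT-3; companion of `SecantParityPositivity.lean`; files of record
# `s4push/prove-1/ATTEMPT-1.md` §2, `s4push/prove-1/STATEMENTS-S3INPUT.md` S3INP-3)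

HONEST FRAMING. Lean index of the computation cell `pub-hsemireg`. LINEAR ALGEBRA OVER `ℂ` ONLY, in a MODEL of [Markman,
arXiv:2502.03415, §2.4]: `E` stands for `H¹(X̂, ℂ)`, `Module.Dual ℂ E` for `H¹(X, ℂ)`, `V := Dual E × E` with the pairing
`((φ,y),(φ',y')) = φ(y') + φ'(y)` (Markman's `( , )_V`), `J` for the complex structure of the weight-one Hodge structure of `X̂`
(so `I_V(φ, y) := (-φ ∘ J, J y)`: "`I_X̂` acts by composing with `-I_X`"), `a, b` for the two rational `(1,1)`-classes of the secant
exponent `B = a + t·b`, `t = √-d` (`t² = -d`), `B̄ = a - t·b`; `x₁(y) := (-B(y,·), y)` runs through the null space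
`W₁ = exp(B)·H¹(X̂)` of `e^B` (Markman's (2.4.5) with `θ ↦ β_B`), `x₂(y') := (-B̄(y',·), y')` through `W₂`; `f = cm_{√-d}` is `t` on
`W₁` and `-t` on `W₂` ((2.4.1)), `Ξ_P(x,x') = (f x, x')_V` ((2.4.2)), `g_P(x,x') = Ξ_P(I x, x')`.  The model evaluates `g_P` on the
parametrised points `x = x₁(y) + x₂(y')` (all of `V_ℂ`, as `V_ℂ = W₁ ⊕ W₂`).  No abelian variety, Hodge structure, spinor or
polarisation is constructed; that this model IS Markman's `(V, W₁, W₂, f, Ξ_P, g_P)` for a `K`-secant `P` with `ℓ₁ = K·e^B` is the PAPER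
dictionary of ATTEMPT-1 §2 (each identification is a displayed formula of [Mar25 §2.4]).  Nothing here says HC, HC_CM or HC_AV holds.

*What it indexes (on paper).* ATTEMPT-1 §2 / S3INP-3: substituting `θ ↦ β_B` in the printed proof of [Mar25 Prop. 2.4.4] gives
`g_P(x,x) = -4d·b(ȳ ∧ I y)`, so `(X × X̂, η_P, ±Ξ_P)` is POLARISED iff `±b` is a polarisation of `X` — which puts every polarising
`K`-secant plane in the range where (H1) `∫_X bⁿ > 0` holds (index `0` or `n`; `SecantParityPositivity`).  KERNEL HERE:
**`IV_IV`**, **`pairV_IV`** — `I_V² = -1` and `I_V` is an isometry of `( , )_V` (the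
footnote's two properties); **`IV_x₁`** — `I_V` maps `W₁` to itself through `J` (`I_V x₁(y) = x₁(Jy)`), i.e. `β_B` is a morphism of Hodge structures, BECAUSE
`B` is `J`-invariant and `J² = -1`; **`pairV_x₁_x₁`** (`W₁` isotropic), **`pairV_x₁_x₂`** (`(x₁ u, x₂ v)_V = -(B - B̄)(u,v)`);
**`pairV_f_eq`** — for `x = x₁(y) + x₂(y')`: `(f(x₁(Jy) + x₂(Jy')), x)_V = 2d·(b(Jy, y') + b(Jy', y))` (only alternation of
`a, b` and `t² = -d` are used; the real part `a` DROPS OUT); **`gP_eq`** — the same with `I_V` computed: `(f I_V x, x)_V =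
2d·(b(Jy, y') + b(Jy', y))`; **`b_realPoint` / `gP_eq_realPoint`** — for a REAL point (`y = a' + i b'`, `y' = a' - i b'`):
`(f I_V x, x)_V = 4d·(b(Ja', a') + b(Jb', b')) = -4d·(b(a', Ja') + b(b', Jb'))` — Markman's `-4d·Θ(ȳ ∧ I(y))` with `Θ ↦ b`
(that `a', b'` range over `H¹(X̂, ℝ)` and that `a' ↦ b(a', J a')` is the Hermitian form of `b` is the paper dictionary).

CONTENT (all PROVED, 0 sorry; definitions with bodies `pairV`, `IV`, `x₁`; no named facts), namespace
`Summit.Ventures.HSemireg.SecantParity.Polarisation`.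

## References

* [Markman2025SecantWeil] E. Markman, arXiv:2502.03415 (UNREFEREED), §2.4: (2.4.1)–(2.4.5), Lemma 2.4.2, Prop. 2.4.4 and its proof.
* s4-prove-1, s4push/prove-1/ATTEMPT-1.md §2; STATEMENTS-S3INPUT.md S3INP-3.
-/

noncomputable section

namespace Summit.Ventures.HSemireg

namespace SecantParity

namespace Polarisation

variable {E : Type*} [AddCommGroup E] [Module ℂ E]

/-- Markman's symmetric pairing on `V = H¹(X) ⊕ H¹(X̂)`, modelled on `Dual E × E`: `((φ,y),(φ',y')) = φ(y') + φ'(y)`.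
[cite: Markman2025SecantWeil, §2.4 Lemma 2.4.2 (footnote: the pairing on V)] -/
def pairV (x x' : Module.Dual ℂ E × E) : ℂ := x.1 x'.2 + x'.1 x.2

/-- The complex structure of `V_ℝ`, modelled as the linear map `I_V(φ, y) := (-φ ∘ J, J y)` ("`I_X̂` acts by composing with `-I_X`").
[cite: Markman2025SecantWeil, §2.4 Lemma 2.4.2 (footnote)] -/
def IV (J : E →ₗ[ℂ] E) : (Module.Dual ℂ E × E) →ₗ[ℂ] (Module.Dual ℂ E × E) :=
  LinearMap.prodMap (-J.dualMap) J

/-- The points `x₁(y) := (-β_B(y), y)`, `β_B(y) = B(y, ·)`, of the null space `W₁ = exp(B)·H¹(X̂)` of the pure spinor `e^B`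
(and, with `B̄` for `B`, the points `x₂(y')` of `W₂`). [cite: Markman2025SecantWeil, §2.4 eq. (2.4.5)] -/
def x₁ (B : E →ₗ[ℂ] E →ₗ[ℂ] ℂ) (y : E) : Module.Dual ℂ E × E := (-(B y), y)

/-- `I_V (φ, y) = (-φ ∘ J, J y)` componentwise. [cite: Markman2025SecantWeil, §2.4 Lemma 2.4.2 (footnote)] -/
theorem IV_apply (J : E →ₗ[ℂ] E) (x : Module.Dual ℂ E × E) : IV J x = (-(x.1 ∘ₗ J), J x.2) := rfl

/-- `I_V² = -1`. [cite: Markman2025SecantWeil, §2.4 Lemma 2.4.2 (footnote)] -/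
theorem IV_IV {J : E →ₗ[ℂ] E} (hJ : ∀ v, J (J v) = -v) (x : Module.Dual ℂ E × E) : IV J (IV J x) = -x := by
  refine Prod.ext ?_ ?_
  · ext v
    simp only [IV_apply, LinearMap.neg_comp, neg_neg, LinearMap.coe_comp, Function.comp_apply,
      Prod.fst_neg, LinearMap.neg_apply, hJ, map_neg]
  · simp only [IV_apply, Prod.snd_neg, hJ]

/-- `I_V` is an ISOMETRY of `( , )_V` («`(I_X, I_X̂)` is an isometry of `H₁(X,ℝ) ⊕ H₁(X̂,ℝ)` with respect to the pairing»).
[cite: Markman2025SecantWeil, §2.4 Lemma 2.4.2 (footnote)] -/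
theorem pairV_IV {J : E →ₗ[ℂ] E} (hJ : ∀ v, J (J v) = -v) (x x' : Module.Dual ℂ E × E) :
    pairV (IV J x) (IV J x') = pairV x x' := by
  simp only [pairV, IV_apply, LinearMap.neg_apply, LinearMap.coe_comp, Function.comp_apply, hJ, map_neg, neg_neg]

/-- `W₁` is ISOTROPIC for `( , )_V` when `B` is alternating. [cite: Markman2025SecantWeil, §2.2] -/
theorem pairV_x₁_x₁ {B : E →ₗ[ℂ] E →ₗ[ℂ] ℂ} (hB : ∀ u v, B u v = -B v u) (u v : E) : pairV (x₁ B u) (x₁ B v) = 0 := by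
  simp only [pairV, x₁, LinearMap.neg_apply]
  rw [hB u v]; ring

/-- **The cross pairing** `(x₁(u), x₂(v))_V = -(B - B̄)(u, v)` between `W₁` (exponent `B`) and `W₂` (exponent `B̄`), `B̄` alternating.
[cite: Markman2025SecantWeil, §2.4 proof of Prop. 2.4.4] -/
theorem pairV_x₁_x₂ {B B' : E →ₗ[ℂ] E →ₗ[ℂ] ℂ} (hB' : ∀ u v, B' u v = -B' v u) (u v : E) :
    pairV (x₁ B u) (x₁ B' v) = -(B u v - B' u v) := by
  simp only [pairV, x₁, LinearMap.neg_apply]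
  rw [hB' v u]; ring

/-- **`I_V` preserves `W₁` and acts there through `J`**: `I_V(x₁(y)) = x₁(J y)` — i.e. `β_B : H¹(X̂) → H¹(X)` is a morphism of
Hodge structures — because `B` is `J`-invariant (`B(Ju, Jv) = B(u, v)`: `a, b` of type `(1,1)`) and `J² = -1`.
[cite: Markman2025SecantWeil, §2.4 (θ is an isomorphism of rational Hodge structures)] -/
theorem IV_x₁ {J : E →ₗ[ℂ] E} (hJ : ∀ v, J (J v) = -v) {B : E →ₗ[ℂ] E →ₗ[ℂ] ℂ} (hBJ : ∀ u v, B (J u) (J v) = B u v)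
    (y : E) : IV J (x₁ B y) = x₁ B (J y) := by
  have h : ∀ v, B y (J v) = -(B (J y) v) := fun v ↦ by
    have h1 := hBJ y (J v)
    rw [hJ, map_neg] at h1
    exact h1.symm
  refine Prod.ext ?_ rfl
  ext v
  simp only [IV_apply, x₁, LinearMap.neg_comp, neg_neg, LinearMap.coe_comp, Function.comp_apply, LinearMap.neg_apply]
  exact h v

/-- `I_V` on a point `x₁(y) + x₂(y')` of `V_ℂ = W₁ ⊕ W₂`: `I_V x = x₁(Jy) + x₂(Jy')`.
[cite: Markman2025SecantWeil, §2.4 Lemma «decomposition into four direct summands»] -/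
theorem IV_x₁_add_x₂ {J : E →ₗ[ℂ] E} (hJ : ∀ v, J (J v) = -v) {B B' : E →ₗ[ℂ] E →ₗ[ℂ] ℂ}
    (hBJ : ∀ u v, B (J u) (J v) = B u v) (hB'J : ∀ u v, B' (J u) (J v) = B' u v) (y y' : E) :
    IV J (x₁ B y + x₁ B' y') = x₁ B (J y) + x₁ B' (J y') := by
  rw [map_add, IV_x₁ hJ hBJ, IV_x₁ hJ hB'J]

/-- **Markman's `g_P` in `W`-coordinates, the core identity**: with `B = a + t·b`, `B̄ = a - t·b` (`a, b` alternating), `t² = -d`,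
and `f = t` on `W₁`, `-t` on `W₂` ((2.4.1)): for `x = x₁(y) + x₂(y')` and `x' := x₁(Jy) + x₂(Jy')` (which is `I_V x`, `IV_x₁_add_x₂`),
`(f x', x)_V = 2d·(b(Jy, y') + b(Jy', y))` — the diagonal terms vanish by isotropy, the cross terms are `∓t·(B - B̄) = ∓2t²·b`, and the
REAL PART `a` OF THE EXPONENT DROPS OUT.  (`J` enters only through the arguments `Jy, Jy'`; no `J`-invariance is used here.)
[cite: Markman2025SecantWeil, §2.4 Lemma 2.4.2 and proof of Prop. 2.4.4] -/
theorem pairV_f_eq (a b B B' : E →ₗ[ℂ] E →ₗ[ℂ] ℂ) (t d : ℂ) (ht : t ^ 2 = -d)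
    (hB : ∀ u v, B u v = a u v + t * b u v) (hB' : ∀ u v, B' u v = a u v - t * b u v)
    (ha : ∀ u v, a u v = -a v u) (hb : ∀ u v, b u v = -b v u) (J : E →ₗ[ℂ] E) (y y' : E) :
    pairV (t • x₁ B (J y) - t • x₁ B' (J y')) (x₁ B y + x₁ B' y') = 2 * d * (b (J y) y' + b (J y') y) := by
  simp only [pairV, x₁, Prod.fst_add, Prod.snd_add, Prod.fst_sub, Prod.snd_sub, Prod.smul_fst, Prod.smul_snd,
    LinearMap.add_apply, LinearMap.sub_apply, LinearMap.smul_apply, LinearMap.neg_apply, map_add, map_sub, map_smul,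
    smul_eq_mul, hB, hB']
  rw [ha y (J y), hb y (J y), ha y' (J y'), hb y' (J y'), ha y (J y'), hb y (J y'), ha y' (J y), hb y' (J y)]
  linear_combination (-2 * (b (J y) y' + b (J y') y)) * ht

/-- **`g_P(x, x) = (f I_V x, x)_V = 2d·(b(Jy, y') + b(Jy', y))`** for `x = x₁(y) + x₂(y')`, with `I_V` COMPUTED from the two
weight-one Hodge structures (`IV_x₁_add_x₂`, which is where the `J`-invariance of `a` and `b` — type `(1,1)` — is used).  For a real
point (`y' = ȳ`) the right side is `4d·Re b(Jy, ȳ) = -4d·(b(a', J a') + b(b', J b'))` (`y = a' + i b'`): `g_P` is definite iff `±b` is a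
positive `(1,1)`-class, i.e. `(X × X̂, η_P, ±Ξ_P)` is polarised iff `±b` is a polarisation of `X` (ATTEMPT-1 §2; for `b = Θ` ample this is
[Mar25 Prop. 2.4.4] itself). [cite: Markman2025SecantWeil, §2.4 Prop. 2.4.4 and its proof] -/
theorem gP_eq {J : E →ₗ[ℂ] E} (hJ : ∀ v, J (J v) = -v) (a b B B' : E →ₗ[ℂ] E →ₗ[ℂ] ℂ) (t d : ℂ) (ht : t ^ 2 = -d)
    (hB : ∀ u v, B u v = a u v + t * b u v) (hB' : ∀ u v, B' u v = a u v - t * b u v)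
    (ha : ∀ u v, a u v = -a v u) (hb : ∀ u v, b u v = -b v u)
    (haJ : ∀ u v, a (J u) (J v) = a u v) (hbJ : ∀ u v, b (J u) (J v) = b u v) (y y' : E)
    (f : Module.Dual ℂ E × E → Module.Dual ℂ E × E)
    (hf : ∀ z z' : E, f (x₁ B z + x₁ B' z') = t • x₁ B z - t • x₁ B' z') :
    pairV (f (IV J (x₁ B y + x₁ B' y'))) (x₁ B y + x₁ B' y') = 2 * d * (b (J y) y' + b (J y') y) := by
  have hBJ : ∀ u v, B (J u) (J v) = B u v := fun u v ↦ by rw [hB, hB, haJ, hbJ]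
  have hB'J : ∀ u v, B' (J u) (J v) = B' u v := fun u v ↦ by rw [hB', hB', haJ, hbJ]
  rw [IV_x₁_add_x₂ hJ hBJ hB'J, hf, pairV_f_eq a b B B' t d ht hB hB' ha hb]

/-- **Real points.** For `y = a' + i·b'` and `y' = a' - i·b'` (on paper: `y' = ȳ` with `a', b'` real, i.e. `x = x₁(y) + x₂(ȳ)` a
REAL vector of `V`), alternation and `J`-invariance of `b` give `b(Jy, y') + b(Jy', y) = 2·(b(Ja', a') + b(Jb', b'))` — the cross
terms cancel.  [cite: Markman2025SecantWeil, §2.4 proof of Prop. 2.4.4 (last three lines)] -/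
theorem b_realPoint {J : E →ₗ[ℂ] E} (hJ : ∀ v, J (J v) = -v) {b : E →ₗ[ℂ] E →ₗ[ℂ] ℂ} (hb : ∀ u v, b u v = -b v u)
    (hbJ : ∀ u v, b (J u) (J v) = b u v) (a' b' : E) :
    b (J (a' + Complex.I • b')) (a' - Complex.I • b') + b (J (a' - Complex.I • b')) (a' + Complex.I • b') =
      2 * (b (J a') a' + b (J b') b') := by
  have h1 : b (J b') a' = b (J a') b' := by
    rw [hb (J b') a', ← hbJ a' (J b'), hJ, map_neg, neg_neg]
  simp only [map_add, map_sub, map_smul, LinearMap.add_apply, LinearMap.sub_apply, LinearMap.smul_apply, smul_eq_mul]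
  rw [h1]
  linear_combination (-2 * b (J b') b') * Complex.I_sq

/-- **`g_P` at a real point**: for `x = x₁(a' + i b') + x₂(a' - i b')`,
`(f I_V x, x)_V = 4d·(b(Ja', a') + b(Jb', b'))` (`= -4d·(b(a', Ja') + b(b', Jb'))`, Markman's `-4d·Θ(ȳ ∧ I y)` with `Θ ↦ b`).
Hence (paper): `g_P` is definite on `V_ℝ` iff the quadratic form `a' ↦ b(a', J a')` is definite on `H¹(X̂, ℝ)`, i.e. iff `b` or `-b`
is a positive `(1,1)`-class — `(X × X̂, η_P, ±Ξ_P)` is a polarised abelian variety of Weil type iff `±b` is a polarisation of `X`.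
[cite: Markman2025SecantWeil, §2.4 Prop. 2.4.4 and its proof] -/
theorem gP_eq_realPoint {J : E →ₗ[ℂ] E} (hJ : ∀ v, J (J v) = -v) (a b B B' : E →ₗ[ℂ] E →ₗ[ℂ] ℂ) (t d : ℂ)
    (ht : t ^ 2 = -d) (hB : ∀ u v, B u v = a u v + t * b u v) (hB' : ∀ u v, B' u v = a u v - t * b u v)
    (ha : ∀ u v, a u v = -a v u) (hb : ∀ u v, b u v = -b v u)
    (haJ : ∀ u v, a (J u) (J v) = a u v) (hbJ : ∀ u v, b (J u) (J v) = b u v) (a' b' : E)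
    (f : Module.Dual ℂ E × E → Module.Dual ℂ E × E)
    (hf : ∀ z z' : E, f (x₁ B z + x₁ B' z') = t • x₁ B z - t • x₁ B' z') :
    pairV (f (IV J (x₁ B (a' + Complex.I • b') + x₁ B' (a' - Complex.I • b'))))
        (x₁ B (a' + Complex.I • b') + x₁ B' (a' - Complex.I • b')) = 4 * d * (b (J a') a' + b (J b') b') := by
  rw [gP_eq hJ a b B B' t d ht hB hB' ha hb haJ hbJ _ _ f hf, b_realPoint hJ hb hbJ]
  ring

end Polarisation

end SecantParity

end Summit.Ventures.HSemireg
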